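import Summits.Langlands.Langlands.Statement
import Literature.NumberTheory.GaloisRepresentations.SymplecticMultiplier
import HarnessLib

/-!
# On-path lemma (F4) for the rung `SymplecticOddAbelianQ 2` of line `SymplecticOddAbelianQ2`
# (crux `ReciprocityUpToIrreducibility`, item stmt-Langlands-14328; G4 ladder-down, generation 8)

`Langlands → SymplecticOddAbelianQ g` for every `0 < g` (in particular the rung `g = 2` and every
higher rung): clause (B) of the summit over `ℚ` at any reciprocity datum — one exists by the `Nonempty`
conjunct of the Statement — applies to every `ρ` on the sector, because the sector's de Rham clause is
stated against the PINNED Fontaine datum `fontainePstAdicCompletion v ℓ hv`, which is `Rec.pst ℓ v hv`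
by definition (`ReciprocityData.pst`), so the sector hypotheses give `IsGeometricFramed Rec ρ` (the
Hodge–Tate-multiset clause and the polarization clause are simply not used); `Corresponds Rec ι π ρ`
contains a.e. Satake–Frobenius matching as its first conjunct.  The family is VERBATIM the one of
`Lines/SymplecticOddAbelianQ2.lean`.  Sorry-free; standard axioms.
-/

noncomputable section

set_option linter.dupNamespace false

open scoped MatrixGroups Matrix NumberField Classical Polynomial
open Filter IsDedekindDomain Field Polynomial
open Literature.NumberTheory.Automorphic Literature.NumberTheory.GaloisRepresentations
open Literature.NumberTheory.PAdicHodge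
open Summit.Langlands

namespace Summit.Langlands.Langlands.Cruxes.ReciprocityUpToIrreducibility.SymplecticOddAbelianQ2.OnPath

/-- **The rung family** (dial = abelian genus `g`, rank `2g`): clause (B) of the summit over `ℚ`
restricted to the symplectic-odd Fontaine–Mazur sector of ABELIAN HODGE TYPE at odd `ℓ` —
`ρ : Γ_ℚ → GL_{2g}(ℚ̄_ℓ)` irreducible, preserving a non-degenerate alternating form up to a multiplier
`μ` with `μ(c) = -1` at complex conjugation (GSp-oddness, Boxer–Calegari–Gee–Pilloni 2021 §7.6),
unramified a.e., de Rham at `ℓ` for the PINNED Fontaine datum `fontainePstAdicCompletion v ℓ hv` with,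
at every label, Hodge–Tate multiset `{a,…,a, a+1,…,a+1}` (`g` copies each; `a ∈ ℤ` free — both sign
conventions) — conclusion: an L-algebraic cuspidal `π` of `GL_{2g}(𝔸_ℚ)` with Satake–Frobenius
matching at almost all places.  `g = 1`: regular weight, the tree's `OddPrimesRegularFM` restricted to
consecutive weights; `g = 2`: abelian-surface type, IRREGULAR (`{a,a,a+1,a+1}`).
[cite: BoxerEtAl2021, §7.6] [cite: FontaineMazurGeometric1995, Conj. 1] -/
def SymplecticOddAbelianQ (g : ℕ) : Prop :=
  ∀ (ℓ : ℕ) [Fact ℓ.Prime], ℓ ≠ 2 →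
    ∀ (ρ : Literature.NumberTheory.GaloisRepresentations.FramedGaloisRep ℚ (PadicAlgCl ℓ) (2 * g)),
      ρ.toGaloisRep.IsIrreducible →
      (∃ μ : Field.absoluteGaloisGroup ℚ → PadicAlgCl ℓ, ρ.IsSymplecticWithMultiplierFun μ ∧
        ∀ (φ : ℚ →+* ℝ) (c : Field.absoluteGaloisGroup ℚ),
          Literature.NumberTheory.GaloisRepresentations.IsComplexConjugation φ c → μ c = -1) →
      (∀ᶠ v : IsDedekindDomain.HeightOneSpectrum (NumberField.RingOfIntegers ℚ) in Filter.cofinite,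
        ρ.IsUnramifiedAt v) →
      (∀ (v : IsDedekindDomain.HeightOneSpectrum (NumberField.RingOfIntegers ℚ))
        (hv : ((ℓ : ℕ) : NumberField.RingOfIntegers ℚ) ∈ v.asIdeal),
        (Literature.NumberTheory.PAdicHodge.fontainePstAdicCompletion v ℓ hv).IsDeRhamFramed (ρ.toLocal v) ∧
        ∀ τ : v.adicCompletion ℚ →+* PadicAlgCl ℓ, Continuous τ →
          ∃ a : ℤ, ρ.labelledHodgeTateWeightsAt v
            (Literature.NumberTheory.PAdicHodge.fontainePstAdicCompletion v ℓ hv).algebra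
            (Literature.NumberTheory.PAdicHodge.fontainePstAdicCompletion v ℓ hv).𝔅 τ =
            Multiset.replicate g a + Multiset.replicate g (a + 1)) →
      ∀ (hcpt : Literature.NumberTheory.Automorphic.isCompact_glFiniteIntegralLevel (2 * g) ℚ)
        (ι : PadicAlgCl ℓ ≃+* ℂ),
        ∃ π : Literature.NumberTheory.Automorphic.CuspidalAutomorphicRepData (2 * g) ℚ hcpt,
          π.1.IsLAlgebraic ∧
          ∀ᶠ v : IsDedekindDomain.HeightOneSpectrum (NumberField.RingOfIntegers ℚ) in Filter.cofinite,
            Summit.Langlands.SatakeFrobCompatibleAt ι π.1 ρ v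

/-- **THE RUNG** (the filed statement): the family at genus `g = 2` — reciprocity (B) for irreducible,
odd-symplectic (`GSp₄`-type) `ρ : Γ_ℚ → GL₄(ℚ̄_ℓ)` of abelian-surface Hodge type `{a,a,a+1,a+1}`,
`ℓ` odd: the Fontaine–Mazur–Langlands form of the paramodular (Brumer–Kramer) conjecture.
[cite: BoxerEtAl2021, Thm. 1.1.3] [cite: BoxerCalegariGeePilloni2025, Thm. 1.1] -/
def SymplecticOddAbelianQ2 : Prop := SymplecticOddAbelianQ 2

section OnPath

/-- **Dial monotonicity in the summit direction** (F4): the summit gives every rung `g ≥ 1` — clause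
(B) at any reciprocity datum (one exists by the `Nonempty` conjunct) applies on the sector because
the sector's de Rham clause is stated against the pinned datum `= Rec.pst ℓ v hv` (`rfl`), and
`Corresponds` contains a.e. Satake–Frobenius matching; the Hodge-type clause is simply not needed. -/
theorem symplecticOddAbelianQ_of_langlands {g : ℕ} (hg : 0 < g) (hL : _root_.Langlands) :
    SymplecticOddAbelianQ g := by
  intro ℓ _ _hℓ ρ hirr _hsymp hunr hdR hcpt ι
  obtain ⟨⟨Rec⟩, hall⟩ := hL ℚ
  have hB : GaloisToAutomorphic (2 * g) Rec hcpt := (hall Rec (2 * g) (by omega) hcpt).2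
  have hgeo : IsGeometricFramed Rec ρ := ⟨hunr, fun v hv => (hdR v hv).1⟩
  obtain ⟨π, hLalg, hcorr⟩ := hB ℓ ι ρ hirr hgeo
  exact ⟨π, hLalg, hcorr.1⟩

/-- **F4 on-path lemma for the rung**: `Langlands → SymplecticOddAbelianQ2`. -/
@[aesop safe apply]
theorem SymplecticOddAbelianQ2_of_Langlands (hL : _root_.Langlands) : SymplecticOddAbelianQ2 :=
  symplecticOddAbelianQ_of_langlands (by norm_num) hL

end OnPath

end Summit.Langlands.Langlands.Cruxes.ReciprocityUpToIrreducibility.SymplecticOddAbelianQ2.OnPath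

end
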